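import Literature.IUT.LogVolume.Theorem110StepIIITowerNonVacuity
import Literature.NumberTheory.NumberFields.RelativeDifferentExponentsTower
import Literature.NumberTheory.NumberFields.DifferentIdealIntBase
import HarnessLib

/-!
# [IUTchIV] Theorem 1.10, Step (ii) at the GENUINE place data of a real tower: the relative form of
# Prop. 1.3 (i) and the first display `log(𝔡^{L₀}) + log(𝔣^{L₀}) ≤ log(𝔡^L) + log(𝔣^L)`

Mochizuki, *Inter-universal Teichmüller theory IV*, RIMS manuscript (Apr. 2020; = PRIMS **57** (2021)),
proof of Thm. 1.10, Step (ii), p. 24: "the inequality `log(𝔡^{F_tpd}) + log(𝔣^{F_tpd}) ≤ log(𝔡^F) + log(𝔣^F)`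
follows immediately from Proposition 1.3, (i)".  The tree's `Theorem110StepII.lean` (abc-iut-S3) proves this
display over ABSTRACT two-level place data `Thm110StepII.PlaceData V W` from the per-place hypothesis
`h13i : d_w ≥ d_v + (e_{w/v} − 1)/e_w` (`PlaceData.first_display`), and `Theorem110StepIIITowerNonVacuity.lean`
(this seat) shows that `PlaceData`/`StepIIITower` are inhabited by the genuine invariants of every extension of
number fields `F ⊆ K` over any finite set `S` of finite places of `F`.

THIS FILE (theorems only) DISCHARGES `h13i` at that genuine data, i.e. proves the relative Prop. 1.3 (i) in the
normalised-exponent form used by Step (ii):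

* `multiplicity_absDifferent_tower` — transitivity of the different down to `ℤ`, exponent by exponent:
  `ord_w 𝔡_{K/ℚ} = ord_w 𝔡_{K/F} + e(w|v)·ord_v 𝔡_{F/ℚ}` (tree `multiplicity_differentIdeal_tower` for
  `ℚ ⊆ F ⊆ K` + `𝔡_{·/ℤ} = 𝔡_{·/𝓞ℚ}`);
* `ramificationIdx_rel_mul_add_le_multiplicity_absDifferent` — hence, by Dedekind's `e(w|v) − 1 ≤ ord_w 𝔡_{K/F}`:
  `e(w|v)·ord_v 𝔡_{F/ℚ} + (e(w|v) − 1) ≤ ord_w 𝔡_{K/ℚ}`;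
* `PlaceData.prop13iRel_of_genuine` — for ANY place data whose `e_v, d_v, e_{w/v}, d_w` are the genuine
  `e(v|p), ord_v(𝔡_{F/ℚ})/e(v|p), e(w|v), ord_w(𝔡_{K/ℚ})/e(w|p)`: `d_v + (e_{w/v} − 1)/(e_{w/v}·e_v) ≤ d_w`
  (divide the previous line by `e(w|p) = e(v|p)·e(w|v)`);
* `PlaceData.first_display_of_genuine` — THE FIRST DISPLAY at genuine data, unconditionally;
* `Thm110StepIII.exists_stepIIITower_first_display` — packaged with the genuine `StepIIITower` of
  `Theorem110StepIIITowerNonVacuity.lean`: at every real tower both the Step (ii) first display and the Step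
  (iii) bound on the distinguished primes hold for the genuine numbers.

(The cell also proves the first display for real fields directly in arithmetic-divisor vocabulary,
`DifferentConductorTower.ndeg_different_add_reduced_mono`; the present file is the bridge showing that the
ABSTRACT Step (ii) assembly is instantiated by real towers, answering the "numeric shadow" concern on the
`PlaceData` files.)  Classical algebraic number theory; nothing here takes a side on [IUTchIII] Cor. 3.12.
-/

noncomputable section

namespace Literature.IUT.LogVolume

open NumberField IsDedekindDomain Finset
open Literature.NumberTheory.NumberFields (multiplicity_differentIdeal_tower
  ramificationIdx_sub_one_le_multiplicity_differentIdeal differentIdeal_int_eq_differentIdeal_ringOfIntegers_rat)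
open scoped Classical

variable (F K : Type*) [Field F] [NumberField F] [Field K] [NumberField K] [Algebra F K]

/-! ### Transitivity of the different down to `ℤ`, prime by prime -/

section Local

variable {F K}

/-- **`ord_w 𝔡_{K/ℚ} = ord_w 𝔡_{K/F} + e(w|v)·ord_v 𝔡_{F/ℚ}`** for a maximal ideal `w` of `𝓞 K` over
`v = w ∩ 𝓞 F` (transitivity `𝔡_{K/ℚ} = 𝔡_{K/F}·𝔡_{F/ℚ}𝓞_K`, exponent form, with the base presented as `ℤ`).
[cite: NeukirchANT1999, Ch. III (2.2)] -/
theorem multiplicity_absDifferent_tower (w : Ideal (𝓞 K)) [w.IsMaximal] :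
    multiplicity w (differentIdeal ℤ (𝓞 K)) = multiplicity w (differentIdeal (𝓞 F) (𝓞 K)) +
      w.ramificationIdx (𝓞 F) * multiplicity (w.under (𝓞 F)) (differentIdeal ℤ (𝓞 F)) := by
  haveI : IsScalarTower ℚ F K := IsScalarTower.of_algebraMap_eq fun q => by simp [map_ratCast]
  rw [differentIdeal_int_eq_differentIdeal_ringOfIntegers_rat K,
    differentIdeal_int_eq_differentIdeal_ringOfIntegers_rat F]
  exact multiplicity_differentIdeal_tower ℚ F K w

/-- **Relative Prop. 1.3 (i) in absolute exponents**: `e(w|v)·ord_v 𝔡_{F/ℚ} + (e(w|v) − 1) ≤ ord_w 𝔡_{K/ℚ}`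
(the previous identity and Dedekind's `e(w|v) − 1 ≤ ord_w 𝔡_{K/F}`). [cite: NeukirchANT1999, Ch. III (2.6)] -/
theorem ramificationIdx_rel_mul_add_le_multiplicity_absDifferent (w : Ideal (𝓞 K)) [w.IsMaximal] :
    w.ramificationIdx (𝓞 F) * multiplicity (w.under (𝓞 F)) (differentIdeal ℤ (𝓞 F)) +
        (w.ramificationIdx (𝓞 F) - 1) ≤ multiplicity w (differentIdeal ℤ (𝓞 K)) := by
  rw [multiplicity_absDifferent_tower (F := F) w]
  have h := ramificationIdx_sub_one_le_multiplicity_differentIdeal F K w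
  omega

end Local

/-! ### Prop. 1.3 (i), relative form, at genuine place data; the first display -/

namespace Thm110StepII

namespace PlaceData

variable {F K}

/-- **`h13i` DISCHARGED at genuine data**: for place data over `F ⊆ K` indexed by a finite set `S` of finite
places of `F` and the primes of `𝓞 K` over them, whose `e_v, d_v, e_{w/v}, d_w` are the genuine
`e(v|p)`, `ord_v(𝔡_{F/ℚ})/e(v|p)`, `e(w|v)`, `ord_w(𝔡_{K/ℚ})/e(w|p)`, the relative Prop. 1.3 (i)
`d_v + (e_{w/v} − 1)/(e_{w/v}·e_v) ≤ d_w` holds at every `w | v`.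
[cite: Mochizuki2012, IUTchIV Prop. 1.3 (i) p. 12; Thm. 1.10 Step (ii) p. 24] -/
theorem prop13iRel_of_genuine {S : Finset (HeightOneSpectrum (𝓞 F))}
    (T : PlaceData ↥S (fun v => ↥(IsDedekindDomain.primesOverFinset v.1.asIdeal (𝓞 K))))
    (he0 : ∀ v : ↥S, T.e0 v = v.1.asIdeal.ramificationIdx ℤ)
    (hd0 : ∀ v : ↥S, T.d0 v =
      (multiplicity v.1.asIdeal (differentIdeal ℤ (𝓞 F)) : ℝ) / (v.1.asIdeal.ramificationIdx ℤ : ℕ))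
    (herel : ∀ (v : ↥S) (w : ↥(IsDedekindDomain.primesOverFinset v.1.asIdeal (𝓞 K))),
      T.erel v w = Ideal.ramificationIdx' v.1.asIdeal w.1)
    (hd : ∀ (v : ↥S) (w : ↥(IsDedekindDomain.primesOverFinset v.1.asIdeal (𝓞 K))),
      T.d v w = (multiplicity w.1 (differentIdeal ℤ (𝓞 K)) : ℝ) / (w.1.ramificationIdx ℤ : ℕ)) :
    ∀ (v : ↥S) (w : ↥(IsDedekindDomain.primesOverFinset v.1.asIdeal (𝓞 K))),
      T.d0 v + ((T.erel v w : ℝ) - 1) / (T.erel v w * T.e0 v) ≤ T.d v w := by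
  intro v w
  haveI := v.1.isMaximal
  -- `w` is a maximal ideal of `𝓞 K` over `v`
  have hw := w.2
  rw [IsDedekindDomain.mem_primesOverFinset_iff v.1.ne_bot] at hw
  haveI : w.1.IsPrime := hw.1
  haveI : w.1.LiesOver v.1.asIdeal := hw.2
  have hne : w.1 ≠ ⊥ := Ideal.ne_bot_of_mem_primesOver v.1.ne_bot hw
  haveI : w.1.IsMaximal := Ideal.IsPrime.isMaximal inferInstance hne
  have hunder : w.1.under (𝓞 F) = v.1.asIdeal := (Ideal.LiesOver.over (P := w.1) (p := v.1.asIdeal)).symm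
  -- the genuine numbers
  have hrel : Ideal.ramificationIdx' v.1.asIdeal w.1 = w.1.ramificationIdx (𝓞 F) :=
    Ideal.ramificationIdx'_eq_ramificationIdx (p := v.1.asIdeal) (q := w.1) v.1.ne_bot
  have htower : v.1.asIdeal.ramificationIdx ℤ * Ideal.ramificationIdx' v.1.asIdeal w.1 =
      w.1.ramificationIdx ℤ := Thm110StepIII.ramificationIdx_int_mul_ramificationIdx' v.1 w.2
  have hkey := ramificationIdx_rel_mul_add_le_multiplicity_absDifferent (F := F) w.1
  rw [hunder, ← hrel] at hkey
  -- abbreviations and positivity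
  set e : ℕ := v.1.asIdeal.ramificationIdx ℤ with he_def
  set r : ℕ := Ideal.ramificationIdx' v.1.asIdeal w.1 with hr_def
  set a : ℕ := multiplicity v.1.asIdeal (differentIdeal ℤ (𝓞 F)) with ha_def
  set m : ℕ := multiplicity w.1 (differentIdeal ℤ (𝓞 K)) with hm_def
  have he_pos : 0 < e := Ideal.ramificationIdx_pos v.1.asIdeal ℤ
  have hr_pos : 0 < r := Thm110StepIII.ramificationIdx'_pos_of_mem v.1 w.2
  have heR : (0 : ℝ) < e := by exact_mod_cast he_pos
  have hrR : (0 : ℝ) < r := by exact_mod_cast hr_pos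
  -- `r·a + (r - 1) ≤ m` over `ℝ`
  have hkeyR : (r : ℝ) * a + ((r : ℝ) - 1) ≤ m := by
    have h1 : 1 ≤ r := hr_pos
    have : ((r * a + (r - 1) : ℕ) : ℝ) ≤ m := by exact_mod_cast hkey
    push_cast [Nat.cast_sub h1] at this
    linarith
  rw [hd0 v, herel v w, he0 v, hd v w, ← htower]
  push_cast
  have hfrac : (a : ℝ) / e + ((r : ℝ) - 1) / ((r : ℝ) * e) = ((r : ℝ) * a + ((r : ℝ) - 1)) / ((e : ℝ) * r) := by
    field_simp
  rw [hfrac]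
  exact div_le_div_of_nonneg_right hkeyR (by positivity)

/-- **Step (ii), FIRST DISPLAY, at genuine place data — unconditional**:
`log(𝔡^{F}) + log(𝔣^{F}) ≤ log(𝔡^{K}) + log(𝔣^{K})` (`PlaceData.logDiff0 + logCond0 ≤ logDiff + logCond`) for
every place data over a real tower `F ⊆ K` carrying the genuine `e_v, d_v, e_{w/v}, d_w` (S3's
`first_display` with its Prop. 1.3 (i) hypothesis discharged by `prop13iRel_of_genuine`).
[cite: Mochizuki2012, IUTchIV Thm. 1.10 Step (ii) p. 24] -/
theorem first_display_of_genuine {S : Finset (HeightOneSpectrum (𝓞 F))}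
    (T : PlaceData ↥S (fun v => ↥(IsDedekindDomain.primesOverFinset v.1.asIdeal (𝓞 K))))
    (he0 : ∀ v : ↥S, T.e0 v = v.1.asIdeal.ramificationIdx ℤ)
    (hd0 : ∀ v : ↥S, T.d0 v =
      (multiplicity v.1.asIdeal (differentIdeal ℤ (𝓞 F)) : ℝ) / (v.1.asIdeal.ramificationIdx ℤ : ℕ))
    (herel : ∀ (v : ↥S) (w : ↥(IsDedekindDomain.primesOverFinset v.1.asIdeal (𝓞 K))),
      T.erel v w = Ideal.ramificationIdx' v.1.asIdeal w.1)
    (hd : ∀ (v : ↥S) (w : ↥(IsDedekindDomain.primesOverFinset v.1.asIdeal (𝓞 K))),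
      T.d v w = (multiplicity w.1 (differentIdeal ℤ (𝓞 K)) : ℝ) / (w.1.ramificationIdx ℤ : ℕ)) :
    T.logDiff0 + T.logCond0 ≤ T.logDiff + T.logCond :=
  T.first_display (prop13iRel_of_genuine T he0 hd0 herel hd)

end PlaceData

end Thm110StepII

/-! ### Steps (ii) and (iii) together at the genuine `StepIIITower` -/

namespace Thm110StepIII

/-- **Steps (ii) + (iii) at every real tower**: for number fields `F ⊆ K`, a finite set `S` of finite places of
`F`, bad places `Sbad` and `l ≥ 1`, the genuine `StepIIITower` of `exists_stepIIITower_ofNumberFields`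
satisfies BOTH the Step (ii) first display `log(𝔡^F) + log(𝔣^F) ≤ log(𝔡^K) + log(𝔣^K)` and the Step (iii)
bound `log(𝔰^ℚ) ≤ 2·[F:ℚ]·(log(𝔡^K) + log(𝔣^K)) + log(2·3·5·l)` for its genuine numbers — the abstract
assemblies of `Theorem110StepII.lean` / `Theorem110StepIIITower.lean` instantiated, with no residual
hypothesis. [cite: Mochizuki2012, IUTchIV Thm. 1.10 Steps (ii)–(iii) pp. 24–26] -/
theorem exists_stepIIITower_first_display (S Sbad : Finset (HeightOneSpectrum (𝓞 F))) {l : ℕ}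
    (hl : 0 < l) :
    ∃ T : StepIIITower ↥S (fun v => ↥(IsDedekindDomain.primesOverFinset v.1.asIdeal (𝓞 K))),
      T.deg0 = Module.finrank ℚ F ∧ T.n = Module.finrank F K ∧ T.l = l ∧
      (∀ v : ↥S, T.bad v = true ↔ v.1 ∈ Sbad) ∧
      (∀ (v : ↥S) (w : ↥(IsDedekindDomain.primesOverFinset v.1.asIdeal (𝓞 K))),
        T.d v w = (multiplicity w.1 (differentIdeal ℤ (𝓞 K)) : ℝ) / (w.1.ramificationIdx ℤ : ℕ)) ∧
      (∀ q, q ∈ T.dst ↔ (q.Prime ∧ q ∣ 2 * 3 * 5 * l) ∨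
        ∃ v : ↥S, residueChar F v.1 = q ∧ (v.1 ∈ Sbad ∨
          ∀ w : ↥(IsDedekindDomain.primesOverFinset v.1.asIdeal (𝓞 K)),
            0 < multiplicity w.1 (differentIdeal ℤ (𝓞 K)))) ∧
      T.logDiff0 + T.logCond0 ≤ T.logDiff + T.logCond ∧
      T.logsQ ≤ 2 * T.deg0 * (T.logDiff + T.logCond) + Real.log (2 * 3 * 5 * (T.l : ℝ)) := by
  obtain ⟨T, h0, hn, hlT, -, he0, -, hd0, hbad, herel, -, hd, hdst⟩ :=
    exists_stepIIITower_ofNumberFields F K S Sbad hl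
  exact ⟨T, h0, hn, hlT, hbad, hd, hdst,
    Thm110StepII.PlaceData.first_display_of_genuine T.toPlaceData he0 hd0 herel hd, T.logsQ_le⟩

end Thm110StepIII

end Literature.IUT.LogVolume

end
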